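import Summits.BirchSwinnertonDyer.Rank1Residual.Additive.GordManinConstantTwistDegree
import Summits.BirchSwinnertonDyer.Rank1Residual.Additive.PalTwistPeriodHolds
import Literature.NumberTheory.EllipticCurves.ModularDegreeQuadraticTwistProofs
import HarnessLib

/-!
# X3/X4 at an additive prime: THE EXACT TWIST LAW `deg(D♭) · c(D)² = p · deg(D) · c(D♭)²` for
# globally minimal models — `|u| = 1` proved class-wide (Pal 2012 Prop. 2.5: `ũ = 1`), and the
# census law `deg♭ = p · deg` ⟺ `|c♭| = |c|`

HONEST FRAMING (cell `b2b-bsdres`, run/shared/lean/b2b/bsd-rank1-residual/, verbatim in every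
file): the goal of the cell is to DELETE the COMBINATION-SHAPED residual classes of the
Birch–Swinnerton-Dyer formula for ALL analytic-rank `≤ 1` elliptic curves over `ℚ` — "full BSD
formula for every rank `≤ 1` curve in class `C`" assembled STRICTLY from published theorems — so
that the rank-`≤ 1` remainder becomes exactly the CONSTRUCTION-SHAPED classes, which are TYPED
(missing-input `Prop`s), NOT attempted. This is not "finishing BSD". Sub-cell `additive-p2`
(CLASS-OWNERS row "X3/X4 additive — pot. good ordinary / X3♯(G-ord)"), generation 17: research
route; no claim beyond the stated classes; theorems only, no definition, no named fact;
X3♯(G-ord)/X4♯(G-ord) stay CONSTRUCTION-SHAPED; no label moves; nothing is booked.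

WHAT THIS FILE DOES. Two kernel proofs of the twist-degree identity exist (this seat's
`GordTwistDegreeIdentity.lean`, p245947: `p·deg(D)·c(D♭)² = deg(D♭)·u(C)²·c(D)²`; harvest-2's
`Literature/…/ModularDegreeQuadraticTwistProofs.lean`, p246074/p246120:
`deg(D')·c(D)²·u(C)² = p·deg(D)·c(D')²`, with the printed sources — Watkins, Experiment. Math. 11
(2002) §2.1 `V_p = p`; Delaunay 2003 Thm 1; Pal 2012 Lemma 3.1). Both carry the scaling `u(C)` of
the change of variables `C • V^{(p*)} = W`; the Literature twin's integral form
`deg_mul_sq_eq_of_quadraticTwist_pStar_of_abs_u_eq_one` takes `|u| = 1` as a HYPOTHESIS ("e.g. both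
models globally minimal and no re-minimalisation under the twist — Pal 2012, Prop. 2.4/2.5"). This
file PROVES that hypothesis class-wide and states the exact law:
* §1 `valuation_u_eq_one_of_isMinimalAt` — two models of one curve, both minimal at a place `v` of
  `ℤ`, differ by a change of variables with `|u|_v = 1` (Silverman *AEC* VII.1.3 (b); the tree's
  `exists_algebraMap_eq_u_of_isMinimal` over `O_v`); `padicValRat_u_eq_zero_of_isMinimalAt`.
* §2 `padicValRat_u_eq_zero_of_twist_pStar_of_ne` — for `C • V^{(p*)} = W` with `V`, `W` globally
  minimal and a prime `ℓ ≠ p`: `ord_ℓ u(C) = 0` — the twist by `p* = 4k + 1` is UNRAMIFIED at `ℓ`,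
  `V^{(p*)} = C₁ • V.twistModel k` with `u(C₁) = 1` (tree
  `exists_variableChange_twistModel_eq_quadraticTwist`), and `V.twistModel k` is `ℓ`-minimal (tree
  `isMinimalAt_twistModel`; Comalada 1994). With gen 17's `ord_p u(C) = 0` for `ord_p Δ_min(V) < 6`
  (`padicValRat_u_eq_zero_and_padicValInt_eq_of_twist_pStar`): **`abs_u_eq_one_of_twist_pStar`,
  `|u(C)| = 1`** (a rational number with all `ord_ℓ` zero is `±1` — additive-p4's
  `Rat.abs_eq_one_of_forall_padicValRat_eq_zero`, `PalTwistPeriodHolds.lean`, where `|u| = 1` is proved for the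
  SEMISTABLE twist at `p ≡ 1 (mod 4)`). This is Pal 2012 Prop. 2.5 "`ũ = ∏ u_p = 1`" for
  `d = p* ≡ 1 (mod 4)` and `λ_{v_p} < 6`.
* §3 **`twist_modularDegree_identity_exact`: `deg(D♭)·c(D)² = p·deg(D)·c(D♭)²`** in `ℤ` for `V`
  globally minimal, additive potentially good at `p ≥ 5` with `ord_p Δ_min(V) < 6`, `W` a globally
  minimal model of the `p*`-twist, `D`, `D♭` conductor-level data (ANY data) — obtained by feeding §2
  into harvest-2's Literature theorem (the two twins compose); and the reading
  **`natAbs_maninConstant_eq_iff_modularDegree_eq`: `|c(D♭)| = |c(D)| ⟺ deg(D♭) = p·deg(D)`** — the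
  gen-16 census law `deg♭ = p·deg` (85 108 / 85 108 (G-ord) pairs; harvest-2's per-curve recount
  233 931 / 233 933) IS, pair by pair, the equality of the two Manin constants up to sign (Watkins:
  "if we assume the Manin constants are the same"). Nothing here changes a label; no named fact.

References: M. Watkins, Experiment. Math. 11 (2002) §2.1 p. 491 [Watkins2002]; V. Pal, Proc. AMS
140 (2012) Prop. 2.4/2.5, Lemma 3.1 [Pal2012]; C. Delaunay, JTNB 15 (2003) Thm 1 [Delaunay2003];
J. H. Silverman, *AEC* VII.1 Prop. 1.3 (b), VIII.8.3 [SilvermanAEC2009]; S. Comalada, J. Number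
Theory 49 (1994) §2.
-/

noncomputable section

open scoped Classical NumberField

open WeierstrassCurve IsDedekindDomain IsDedekindDomain.HeightOneSpectrum NumberField
  Rat.HeightOneSpectrum Literature.NumberTheory.EllipticCurves
  Literature.NumberTheory.EllipticCurves.ModularForms
  Literature.NumberTheory.EllipticCurves.Rank1Residual
  Literature.NumberTheory.DiophantineGeometry

namespace Summit.BirchSwinnertonDyer.Rank1Residual.Additive

/-! ### §1 Two `v`-minimal models differ by a `v`-unit -/

/-- **Two models of an elliptic curve over `ℚ`, both minimal at the place `v` of `ℤ`, differ by a
change of variables `C` with `|u(C)|_v = 1`** (Silverman *AEC* VII.1 Prop. 1.3 (b): "the equation is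
unique up to a change of coordinates with `u ∈ R^*`"; the tree's `exists_algebraMap_eq_u_of_isMinimal`
over the completed local ring `O_v`, transported back to `v.valuation ℚ`).
[cite: SilvermanAEC2009, VII.1 Prop. 1.3(b)] -/
theorem valuation_u_eq_one_of_isMinimalAt (v : HeightOneSpectrum ℤ) (X : WeierstrassCurve ℚ)
    [X.IsElliptic] (C : VariableChange ℚ) (hX : X.IsMinimalAt v) (hCX : (C • X).IsMinimalAt v) :
    v.valuation ℚ (C.u : ℚ) = 1 := by
  -- the argument of additive-p4's `padicValRat_u_eq_zero_of_twist_pm_p`, for any pair of minimal models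
  haveI hXmin : IsMinimal (v.adicCompletionIntegers ℚ) (X.baseChange (v.adicCompletion ℚ)) := hX
  haveI : IsMinimal (v.adicCompletionIntegers ℚ)
      ((C.baseChange (v.adicCompletion ℚ)) • (X.baseChange (v.adicCompletion ℚ))) := by
    rw [VariableChange.baseChange, baseChange, map_variableChange]
    exact hCX
  have hΔ : (X.baseChange (v.adicCompletion ℚ)).Δ ≠ 0 := by
    rw [baseChange, map_Δ]
    exact (map_ne_zero _).mpr (isUnit_Δ X).ne_zero
  obtain ⟨⟨a, ha⟩, ⟨b, hb⟩⟩ := exists_algebraMap_eq_u_of_isMinimal (v.adicCompletionIntegers ℚ)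
    (X.baseChange (v.adicCompletion ℚ)) (C.baseChange (v.adicCompletion ℚ)) hΔ
  rw [VariableChange.baseChange] at ha hb
  rw [VariableChange.map_u, Units.coe_map, MonoidHom.coe_coe] at ha
  rw [VariableChange.map_u, Units.coe_map_inv, MonoidHom.coe_coe] at hb
  have hu1 : v.valuation ℚ (C.u : ℚ) ≤ 1 := by
    have h := a.2
    rw [HeightOneSpectrum.mem_adicCompletionIntegers, ← ValuationSubring.algebraMap_apply, ha] at h
    rwa [← HeightOneSpectrum.valuedAdicCompletion_eq_valuation']
  have hu2 : v.valuation ℚ (↑C.u⁻¹ : ℚ) ≤ 1 := by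
    have h := b.2
    rw [HeightOneSpectrum.mem_adicCompletionIntegers, ← ValuationSubring.algebraMap_apply, hb] at h
    rwa [← HeightOneSpectrum.valuedAdicCompletion_eq_valuation']
  have hu0 : (C.u : ℚ) ≠ 0 := C.u.ne_zero
  refine le_antisymm hu1 ?_
  rw [Units.val_inv_eq_inv_val, map_inv₀] at hu2
  have hpos : 0 < v.valuation ℚ (C.u : ℚ) := by
    rw [Valuation.pos_iff]
    exact hu0
  exact (inv_le_one₀ hpos).mp hu2

/-- `ord_ℓ u(C) = 0` for a change of variables between two `ℓ`-minimal models (`ℓ` prime;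
`valuation_u_eq_one_of_isMinimalAt` in `padicValRat` form). [cite: SilvermanAEC2009, VII.1 Prop. 1.3(b)] -/
theorem padicValRat_u_eq_zero_of_isMinimalAt (ℓ : ℕ) [hℓ : Fact ℓ.Prime] (X : WeierstrassCurve ℚ)
    [X.IsElliptic] (C : VariableChange ℚ) (hX : X.IsMinimalAt (placeOf ℓ))
    (hCX : (C • X).IsMinimalAt (placeOf ℓ)) : padicValRat ℓ (C.u : ℚ) = 0 := by
  have hval := valuation_u_eq_one_of_isMinimalAt (placeOf ℓ) X C hX hCX
  have h := Rat.HeightOneSpectrum.valuation_eq_exp_neg_padicValRat (placeOf ℓ) C.u.ne_zero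
  rw [hval, natGenerator_placeOf_eq] at h
  have h' : (0 : ℤ) = -padicValRat ℓ (C.u : ℚ) := by
    rw [← WithZero.exp_zero] at h
    exact WithZero.exp_injective h
  omega

/-! ### §2 `ord_ℓ u = 0` away from `p` (unramified twist) and `|u| = 1` -/

/-- **Away from `p` the scaling of `C • V^{(p*)} = W` is an `ℓ`-unit**: for `V`, `W` globally minimal,
`p` odd and a prime `ℓ ≠ p`, `ord_ℓ u(C) = 0`. The twist by `p* = 4k + 1` is unramified at `ℓ`:
`V^{(p*)} = C₁ • V.twistModel k` with `u(C₁) = 1` (tree `exists_variableChange_twistModel_eq_quadraticTwist`)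
and `V.twistModel k` is minimal at `ℓ` (tree `isMinimalAt_twistModel`, `|k|_ℓ ≤ 1`, `|4k+1|_ℓ = 1`);
`W = (C * C₁) • V.twistModel k` is minimal at `ℓ` too, so §1 applies (`u(C * C₁) = u(C)`).
Pal 2012 Prop. 2.5: "`u_p = 1` if `p` is an odd prime not dividing `d`; `u₂ = 1` for `d ≡ 1 (4)`".
[cite: Pal2012, Prop. 2.5] [cite: SilvermanAEC2009, VII.1 Prop. 1.3(b)] -/
theorem padicValRat_u_eq_zero_of_twist_pStar_of_ne (p ℓ : ℕ) [hp : Fact p.Prime]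
    [hℓ : Fact ℓ.Prime] (hp2 : p ≠ 2) (hℓp : ℓ ≠ p) (V W : WeierstrassCurve ℚ) [V.IsElliptic]
    [V.IsGloballyMinimal] [W.IsElliptic] [W.IsGloballyMinimal] (C : VariableChange ℚ)
    (hC : C • V.quadraticTwist ((-1 : ℚ) ^ (p / 2) * p) = W) : padicValRat ℓ (C.u : ℚ) = 0 := by
  obtain ⟨k, hk⟩ := exists_four_mul_add_one_eq_pStar p hp2
  have hkq : (4 * (k : ℚ) + 1) = (-1 : ℚ) ^ (p / 2) * p := by exact_mod_cast hk
  obtain ⟨C₁, hC₁u, hC₁⟩ := exists_variableChange_twistModel_eq_quadraticTwist V (k : ℚ)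
  rw [hkq] at hC₁
  have hd0 : (4 * (k : ℚ) + 1) ≠ 0 := by
    rw [hkq]; exact mul_ne_zero (pow_ne_zero _ (by norm_num)) (by exact_mod_cast hp.out.ne_zero)
  haveI : (V.twistModel (k : ℚ)).IsElliptic := by
    refine ⟨?_⟩
    rw [twistModel_Δ]
    exact (IsUnit.mk0 _ (pow_ne_zero 6 hd0)).mul V.isUnit_Δ
  -- the twist model is `ℓ`-minimal (unramified twist)
  have hkv : (placeOf ℓ).valuation ℚ (k : ℚ) ≤ 1 := by
    rw [show (k : ℚ) = algebraMap ℤ ℚ k from (eq_intCast _ k).symm]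
    exact HeightOneSpectrum.valuation_le_one (placeOf ℓ) k
  have hdv : (placeOf ℓ).valuation ℚ (4 * (k : ℚ) + 1) = 1 := by
    rw [show (4 * (k : ℚ) + 1 : ℚ) = ((4 * k + 1 : ℤ) : ℚ) by push_cast; ring,
      Literature.NumberTheory.EllipticCurves.Rat.valuation_intCast_eq_one_iff, hk,
      natGenerator_placeOf_eq]
    intro h
    have h' : (ℓ : ℤ) ∣ (p : ℤ) := by
      rcases neg_one_pow_eq_or ℤ (p / 2) with h1 | h1 <;> rw [h1] at h <;> simpa using h
    exact hℓp ((Nat.prime_dvd_prime_iff_eq hℓ.out hp.out).mp (by exact_mod_cast h'))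
  have hT : (V.twistModel (k : ℚ)).IsMinimalAt (placeOf ℓ) :=
    isMinimalAt_twistModel (placeOf ℓ) V (IsGloballyMinimal.isMinimalAt_int V (placeOf ℓ)) hkv hdv
  -- `W = (C * C₁) • twistModel` is `ℓ`-minimal
  have hW : ((C * C₁) • V.twistModel (k : ℚ)).IsMinimalAt (placeOf ℓ) := by
    rw [mul_smul, hC₁, hC]
    exact IsGloballyMinimal.isMinimalAt_int W (placeOf ℓ)
  have h := padicValRat_u_eq_zero_of_isMinimalAt ℓ (V.twistModel (k : ℚ)) (C * C₁) hT hW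
  have hu : ((C * C₁).u : ℚ) = (C.u : ℚ) := by
    rw [show (C * C₁).u = C.u * C₁.u from rfl, hC₁u, mul_one]
  rwa [hu] at h

/-- **`|u(C)| = 1`: the minimal model of the `p*`-twist of a globally minimal `V` with
`ord_p Δ_min(V) < 6` is reached WITHOUT re-scaling** (`C • V^{(p*)} = W`, `V`, `W` globally minimal,
`p` odd): `ord_p u = 0` by gen 17's `padicValRat_u_eq_zero_and_padicValInt_eq_of_twist_pStar`
(the twisted model is `p`-minimal when `ord_p Δ_min(V) < 6`), `ord_ℓ u = 0` for `ℓ ≠ p` by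
`padicValRat_u_eq_zero_of_twist_pStar_of_ne`, hence `u = ±1`. Pal 2012 Prop. 2.5: `ũ = ∏ u_p = 1`
for `d ≡ 1 (mod 4)` when `λ_{v_p} < 6` at the primes `p ∣ d`. [cite: Pal2012, Prop. 2.5]
[cite: SilvermanAEC2009, VII.1 Prop. 1.3(b)] -/
theorem abs_u_eq_one_of_twist_pStar (p : ℕ) [hp : Fact p.Prime] (hp2 : p ≠ 2)
    (V W : WeierstrassCurve ℚ) [V.IsElliptic] [V.IsGloballyMinimal] [W.IsElliptic]
    [W.IsGloballyMinimal] (hV : padicValInt p V.minimalDiscriminantInt < 6) (C : VariableChange ℚ)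
    (hC : C • V.quadraticTwist ((-1 : ℚ) ^ (p / 2) * p) = W) : |(C.u : ℚ)| = 1 := by
  refine Rat.abs_eq_one_of_forall_padicValRat_eq_zero C.u.ne_zero fun ℓ hℓ ↦ ?_
  haveI : Fact ℓ.Prime := ⟨hℓ⟩
  by_cases hℓp : ℓ = p
  · subst hℓp
    exact (padicValRat_u_eq_zero_and_padicValInt_eq_of_twist_pStar ℓ hp2 V W hV C hC).1
  · exact padicValRat_u_eq_zero_of_twist_pStar_of_ne p ℓ hp2 hℓp V W C hC

/-! ### §3 The exact law and the reading `deg♭ = p·deg ⟺ |c♭| = |c|` -/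

variable (p : ℕ) [hp : Fact p.Prime]

/-- **THE EXACT TWIST LAW: `deg(D♭) · c(D)² = p · deg(D) · c(D♭)²`** in `ℤ`, for `V/ℚ` globally
minimal, ADDITIVE and potentially good at `p ≥ 5` with `ord_p Δ_min(V) < 6` (Kodaira II / III / IV),
`W` a globally minimal model of its `p*`-twist (`C • V^{(p*)} = W`), and ANY conductor-level
parametrisation data `D` of `V`, `D♭` of `W`. The two kernel twins compose: harvest-2's Literature
theorem `deg_mul_sq_eq_of_quadraticTwist_pStar_of_abs_u_eq_one` (Watkins 2002 §2.1 `V_p = p`) with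
its hypotheses DISCHARGED class-wide by this sub-cell's dictionary — `|u(C)| = 1`
(`abs_u_eq_one_of_twist_pStar`), `aₙ = 0` at the multiples of `p` on both sides (`Addv`, the twist is
additive by `addv_of_twist_pStar`; harvest-2's `LFunction_apply_eq_zero_of_not_good_of_not_mult`),
and the common level `N(W) = N(V)` (`conductorNorm_eq_of_twist_pStar`).
[cite: Watkins2002, §2.1 (p. 491)] [cite: Pal2012, Prop. 2.5 and Lemma 3.1] -/
theorem twist_modularDegree_identity_exact (hp5 : 5 ≤ p) (V W : WeierstrassCurve ℚ) [V.IsElliptic]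
    [V.IsGloballyMinimal] [W.IsElliptic] [W.IsGloballyMinimal] (hV : Addv V p)
    (hj : 0 ≤ padicValRat p V.j) (hV6 : padicValInt p V.minimalDiscriminantInt < 6)
    (C : VariableChange ℚ) (hC : C • V.quadraticTwist ((-1 : ℚ) ^ (p / 2) * p) = W)
    [NeZero (V.conductorNorm ℤ)] [NeZero (W.conductorNorm ℤ)]
    (D : ModularParametrizationData V (V.conductorNorm ℤ))
    (D' : ModularParametrizationData W (W.conductorNorm ℤ)) :
    (D'.modularDegree : ℤ) * D.maninConstant ^ 2 = p * D.modularDegree * D'.maninConstant ^ 2 := by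
  have hp2 : p ≠ 2 := by omega
  obtain ⟨hW, -, -⟩ := addv_of_twist_pStar p hp2 V W hj hV6 C hC
  have hu := abs_u_eq_one_of_twist_pStar p hp2 V W hV6 C hC
  have hN : W.conductorNorm ℤ = V.conductorNorm ℤ := conductorNorm_eq_of_twist_pStar p hp5 V W hV hW C hC
  obtain ⟨hcast, -⟩ := pStar_intCast p
  have hC' : C • V.quadraticTwist (((-1 : ℤ) ^ (p / 2) * p : ℤ) : ℚ) = W := by rw [hcast]; exact hC
  have hV0 : ∀ n : ℕ, p ∣ n → V.LFunction n = 0 := fun n hn ↦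
    WeierstrassCurve.LFunction_apply_eq_zero_of_not_good_of_not_mult V p hV.1 hV.2 hn
  have hW0 : ∀ n : ℕ, p ∣ n → W.LFunction n = 0 := fun n hn ↦
    WeierstrassCurve.LFunction_apply_eq_zero_of_not_good_of_not_mult W p hW.1 hW.2 hn
  -- move `D'` to the common level and apply the Literature twin
  have key : ∀ (N M : ℕ) [NeZero N] [NeZero M], M = N →
      ∀ (D₁ : ModularParametrizationData V N) (D₂ : ModularParametrizationData W M),
        (D₂.deg : ℤ) * D₁.c ^ 2 = p * D₁.deg * D₂.c ^ 2 := by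
    intro N M _ _ h D₁ D₂
    subst h
    exact ModularParametrizationData.deg_mul_sq_eq_of_quadraticTwist_pStar_of_abs_u_eq_one hp2 C hC'
      hu hV0 hW0 D₁ D₂
  exact key _ _ hN D D'

/-- **THE CENSUS LAW IS THE EQUALITY OF THE MANIN CONSTANTS: `|c(D♭)| = |c(D)| ⟺ deg(D♭) = p·deg(D)`**
(hypotheses of `twist_modularDegree_identity_exact`). For the optimal curves with `c = c♭ = 1`
(Cremona; Manin's conjecture-shaped datum) this is gen 16's `deg_opt(E ⊗ χ_{p*}) = p·deg_opt(E)`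
(85 108 / 85 108 (G-ord) pairs; per curve 233 931 / 233 933, harvest-2 E63); read backwards, every
observed `deg♭ = p·deg` CERTIFIES `|c♭| = |c|` for that pair (Watkins 2002 §2.1: "if we assume the
Manin constants are the same"). [cite: Watkins2002, §2.1 (p. 491)] -/
theorem natAbs_maninConstant_eq_iff_modularDegree_eq (hp5 : 5 ≤ p) (V W : WeierstrassCurve ℚ)
    [V.IsElliptic] [V.IsGloballyMinimal] [W.IsElliptic] [W.IsGloballyMinimal] (hV : Addv V p)
    (hj : 0 ≤ padicValRat p V.j) (hV6 : padicValInt p V.minimalDiscriminantInt < 6)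
    (C : VariableChange ℚ) (hC : C • V.quadraticTwist ((-1 : ℚ) ^ (p / 2) * p) = W)
    [NeZero (V.conductorNorm ℤ)] [NeZero (W.conductorNorm ℤ)]
    (D : ModularParametrizationData V (V.conductorNorm ℤ))
    (D' : ModularParametrizationData W (W.conductorNorm ℤ)) :
    D'.maninConstant.natAbs = D.maninConstant.natAbs ↔ D'.modularDegree = p * D.modularDegree := by
  have h := twist_modularDegree_identity_exact p hp5 V W hV hj hV6 C hC D D'
  have hc0 : D.maninConstant ≠ 0 := D.maninConstant_ne_zero_holds
  have hc0' : D'.maninConstant ≠ 0 := D'.maninConstant_ne_zero_holds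
  have hsq0 : (D'.maninConstant : ℤ) ^ 2 ≠ 0 := pow_ne_zero _ hc0'
  constructor
  · intro hc
    have hsq : D'.maninConstant ^ 2 = D.maninConstant ^ 2 := Int.natAbs_eq_iff_sq_eq.mp hc
    rw [← hsq] at h
    have h' : ((D'.modularDegree : ℤ)) * D'.maninConstant ^ 2 =
        ((p * D.modularDegree : ℕ) : ℤ) * D'.maninConstant ^ 2 := by
      push_cast; linear_combination h
    exact_mod_cast mul_right_cancel₀ hsq0 h'
  · intro hdeg
    rw [hdeg] at h
    push_cast at h
    have hp0 : ((p : ℤ)) * D.modularDegree ≠ 0 :=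
      mul_ne_zero (by exact_mod_cast hp.out.ne_zero) (by exact_mod_cast D.deg_pos.ne')
    have hsq : D.maninConstant ^ 2 = D'.maninConstant ^ 2 := by
      have h' : ((p : ℤ) * D.modularDegree) * D.maninConstant ^ 2 =
          ((p : ℤ) * D.modularDegree) * D'.maninConstant ^ 2 := by linear_combination h
      exact mul_left_cancel₀ hp0 h'
    exact Int.natAbs_eq_iff_sq_eq.mpr hsq.symm

end Summit.BirchSwinnertonDyer.Rank1Residual.Additive

end
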